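import Literature.Barriers.PneNP.PerfectMatchingPolytopeMonotone
import Literature.Barriers.PneNP.MatchingPolytopeExtensionUpperBound
import Literature.Combinatorics.Optimization.BlockPsdFactorization
import Literature.Combinatorics.Optimization.PerfectMatchingPolytopeDimension
import HarnessLib

/-!
# Psd lifts of the perfect matching polytope factorize Edmonds' slack matrices: every psd lift of
# `P_PM(K_n)` has size `≥ C(n,2) − n + 1` (GPT 2013 Thm. 2.4 / FGPRT 2015 Thm. 3.3 + GRT 2013 Prop. 3.2)

The question whether the matching polytope has polynomial psd rank — printed open: "It remains open
whether matching polytopes also have high semidefinite extension complexity" (Fawzi–Gouveia–Parrilo–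
Saunderson–Thomas [FawziEtAl2020], §6 Discussion, ¶ "Lower bounds for spectrahedral lifts", arXiv text
p0030 L47–48) — is about the size of psd LIFTS `P = π(S^k_+ ∩ L)` (the tree's `HasPsdLift`,
Fawzi–Gouveia–Parrilo–Robinson–Thomas [FawziEtAl2015] eq. (3) p09); the working currency of the
matching-psd-rank files of this directory is the psd rank of SLACK MATRICES
(`HasPsdFactorization (pmOddCutSlack n) k`, Edmonds' odd-cut slack matrix `S_{UM} = |δ(U) ∩ M| − 1`,
and `pmFullSlack n`, all of Edmonds' inequality rows).  The two are
tied by the cone-factorization theorem (Gouveia–Parrilo–Thomas [GouveiaParriloThomas2013] Thm. 2.4 =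
Fawzi–Parrilo [FawziParrilo2013] Thm. 2; FGPRT Thm. 3.3 (p09): "the size of the smallest psd lift of a
polytope `P` is equal to the psd rank of the slack matrix `S_P`"), whose direction "lift ⇒ factorization"
the tree PROVES Slater-free for bounded lifted sets and arbitrary families of points and valid
inequalities (`HasBlockPsdLift.hasPsdPowerFactorization_slack`, `BlockPsdLiftFactorization.lean`; for the
odd-cut rows: `HasBlockPsdLift.hasPsdFactorization_pmOddCutSlack`, `BlockPsdFactorization.lean`).

This file spells the dictionary out for ONE block (`(S^k_+)^1`-lifts = psd lifts of size `k`,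
`hasBlockPsdLift_one_iff`) and collects the consequences, all PROVED, no named facts:

* `hasPsdFactorization_pmOddCutSlack_of_hasPsdLift` — a psd lift of `P_PM(K_n)` of size `k ≥ 1` gives
  a psd factorization of size `k` of the odd-cut slack matrix `pmOddCutSlack n`;
* `hasPsdFactorization_pmFullSlack_of_hasPsdLift` — and of the FULL slack matrix `pmFullSlack n` (odd-cut
  rows and nonnegativity rows; the points `χ^M` and both families of valid inequalities fed to
  `HasBlockPsdLift.hasPsdPowerFactorization_slack`; the edge types `Edge n` of the dimension file and
  `EKn n` of the polytope files are identified by `edgeToEKn`);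
* `one_le_of_hasPsdLift_pmPolytope` — for even `n ≥ 2` a psd lift of `P_PM(K_n)` has size `≥ 1`
  (a size-`0` lift is a point `{0}`, but `χ^M ≠ 0`);
* **`choose_two_sub_add_one_le_of_hasPsdLift`** — every psd lift of `P_PM(K_n)`, `n ≥ 4` even, has size
  `≥ C(n,2) − n + 1 = dim P_PM(K_n) + 1`: Gouveia–Robinson–Thomas's `rank_psd ≥ dim + 1`
  [GouveiaRobinsonThomas2013, Prop. 3.2] for Edmonds' slack matrix (tree theorem
  `choose_two_sub_add_one_le_of_hasPsdFactorization`, with the Edmonds–Lovász–Pulleyblank dimension)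
  moved to lifts; the matching-polytope version `choose_two_sub_add_one_le_of_hasPsdLift_edmondsPolytope`
  (`P_PM` is a face of `P_M`, `hasPsdLift_pmPolytope_of_edmondsPolytope`) for all `n ≥ m`, `m ≥ 4` even;
* `psdLift_lowerBound_of_pmOddCutSlack` — the transfer principle for the cell's target: ANY lower bound
  on `rk_psd(pmOddCutSlack n)` is a lower bound on the size of every psd lift of `P_PM(K_n)` (and, by
  `hasPsdLift_pmPolytope_mono`, of `P_PM(K_{n'})` for every even `n' ≥ n`).

* the CONVERSE and **FGPRT Theorem 3.3 for `P_PM(K_n)`**: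
  `hasPsdLift_pmPolytope_iff_hasPsdFactorization_pmFullSlack` — `P_PM(K_n)` has a psd lift of size
  `k ≥ 1` iff `pmFullSlack n` has a psd factorization of size `k` (Edmonds' description as one inequality
  family `edmondsPMRowLHS/RHS`, Edmonds' theorem `setOf_edmondsPMRow_eq_pmPolytope`, and the tree's
  cone-factorization theorem for polytopes `hasPsdPowerFactorization_slack_iff_hasBlockPsdLift`); so
  `{k | P_PM(K_n) has a psd lift of size k} = {k | rk_psd(pmFullSlack n) ≤ k}` (`setOf_hasPsdLift_pmPolytope_eq`).

* **LP lifts are psd lifts** (FGPRT Prop. 2.5: `rank_psd ≤ rank_+`; Yannakakis): an extended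
  formulation of `P_PM(K_n)` of size `r` gives a nonnegative — hence psd — factorization of
  `pmFullSlack n` of size `r + 1` (`hasNonnegFactorization_pmFullSlack_of_hasEF`, the tree's
  `HasEFOfSize.exists_nonneg_factorization` fed the full row family) and so a psd lift of size `r + 1`
  (`hasPsdLift_pmPolytope_of_hasEFOfSize`); with Edmonds' description (`hasEFOfSize_pmPolytope_two_pow`):
  `hasPsdLift_pmPolytope_two_pow_succ` — `P_PM(K_n)` HAS a psd lift of size `2^{n+1} + 1`. The kernel's
  window for the psd rank of `P_PM(K_n)` is thus `[C(n,2) − n + 1, 2^{n+1} + 1]`.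

WHAT THIS IS NOT: no new lower bound on any psd rank is proved here — the best kernel bound for psd
lifts of `P_PM(K_n)` remains the dimension bound `C(n,2) − n + 1`, quadratic in `n`; the question of
[FawziEtAl2020, §6] (superpolynomial?) is open; nothing on P versus NP.

## References

* [GouveiaParriloThomas2013] J. Gouveia, P. A. Parrilo, R. R. Thomas, *Lifts of convex sets and cone
  factorizations*, Math. Oper. Res. 38 (2013) 248–264 — Def. 2.2, Thm. 2.4 (§2).
* [FawziParrilo2013] H. Fawzi, P. A. Parrilo, *Exponential lower bounds on fixed-size psd rank and
  semidefinite extension complexity*, arXiv:1311.2571 — §1.1 (p. 3), Thm. 2 (§2.1, p. 6).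
* [FawziEtAl2015] H. Fawzi, J. Gouveia, P. A. Parrilo, R. Z. Robinson, R. R. Thomas, *Positive
  semidefinite rank*, Math. Program. 153 (2015) 133–177, arXiv:1407.4095 — eq. (3) and Thm. 3.3 (p09),
  Cor. 5.9 (p15).
* [FawziEtAl2020] H. Fawzi, J. Gouveia, P. A. Parrilo, J. Saunderson, R. R. Thomas, *Lifting for
  simplicity: concise descriptions of convex sets*, SIAM Review 64 (2022) 866–918, arXiv:2002.09788 — §6
  (Discussion), ¶ "Lower bounds for spectrahedral lifts" (arXiv text p0030 L44–48: the open question).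
* [GouveiaRobinsonThomas2013] J. Gouveia, R. Z. Robinson, R. R. Thomas, *Polytopes of minimum positive
  semidefinite rank*, Discrete Comput. Geom. 50 (2013) 679–699 — Prop. 3.2 (p07).
* [Edmonds1965] J. Edmonds, *Maximum matching and a polyhedron with 0,1-vertices*, J. Res. Nat. Bur.
  Standards 69B (1965) 125–130 — §2 Thm. (P).
-/

noncomputable section

open Finset Matrix

namespace Literature.Barriers.PneNP

open Literature.Combinatorics.Optimization Literature.Combinatorics.Optimization.FixedSizePsdRank
  Literature.Combinatorics.Optimization.StephenTuncel1999
  Literature.Combinatorics.Optimization.PMPolytopeDim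

variable {n k : ℕ}

/-! ### Psd lifts of `P_PM(K_n)` factorize the odd-cut slack matrix -/

/-- **A psd lift of `P_PM(K_n)` of size `k ≥ 1` gives a psd factorization of size `k` of Edmonds'
odd-cut slack matrix** `S_{UM} = |δ(U) ∩ M| − 1` (one block of the tree's
`HasBlockPsdLift.hasPsdFactorization_pmOddCutSlack`).
[cite: GouveiaParriloThomas2013, Thm. 2.4 (§2)] [cite: FawziEtAl2015, Thm. 3.3 (p09)] -/
theorem hasPsdFactorization_pmOddCutSlack_of_hasPsdLift (hk : 1 ≤ k)
    (h : HasPsdLift (pmPolytope n) k) : HasPsdFactorization (pmOddCutSlack n) k := by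
  have h1 := (hasBlockPsdLift_one_iff.2 h).hasPsdFactorization_pmOddCutSlack hk le_rfl
  rwa [mul_one] at h1

/-! ### Psd lifts of `P_PM(K_n)` factorize the full slack matrix -/

/-- The edge `e` of `K_n` in the coordinates `Edge n = {e // ¬ e.IsDiag}` of the dimension file, as an
edge in the coordinates `EKn n = E(⊤)` of the polytope files. [cite: Edmonds1965, §2 (p. 125)] -/
def edgeToEKn (e : Edge n) : EKn n :=
  ⟨e.1, by rw [SimpleGraph.edgeSet_top]; exact e.2⟩

/-- The underlying pair is unchanged. [cite: Edmonds1965, §2 (p. 125)] -/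
@[simp] theorem coe_edgeToEKn (e : Edge n) : ((edgeToEKn e : EKn n) : Sym2 (Fin n)) = e.1 :=
  rfl

/-- `χ^M` read in either coordinates. [cite: Edmonds1965, §2 (p. 125)] -/
theorem charVec_edgeToEKn (M : PMatch n) (e : Edge n) :
    charVec M.1 (edgeToEKn e) = pmVec n M e :=
  rfl

/-- **A psd lift of `P_PM(K_n)` of size `k ≥ 1` gives a psd factorization of size `k` of Edmonds' FULL
slack matrix** (odd-cut rows `|δ(U) ∩ M| − 1` and nonnegativity rows `χ^M(e)`): the cone-factorization
theorem, direction "lift ⇒ factorization" (`HasBlockPsdLift.hasPsdPowerFactorization_slack`, bounded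
`P_PM`, no Slater point), applied to the points `χ^M` and the valid inequalities `x(δ(U)) ≥ 1`, `x_e ≥ 0`.
[cite: GouveiaParriloThomas2013, Thm. 2.4 (§2)] [cite: FawziParrilo2013, Thm. 2 (§2.1, p. 6)] [cite: FawziEtAl2015, Thm. 3.3 (p09)] -/
theorem hasPsdFactorization_pmFullSlack_of_hasPsdLift (hk : 1 ≤ k)
    (h : HasPsdLift (pmPolytope n) k) : HasPsdFactorization (pmFullSlack n) k := by
  classical
  -- the rows of Edmonds' description in `EKn`-coordinates
  let a : OddSet n ⊕ Edge n → (EKn n → ℝ) :=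
    Sum.elim (fun U => oddCutVec U.1) (fun e => -Pi.single (edgeToEKn e) 1)
  let b : OddSet n ⊕ Edge n → ℝ := Sum.elim (fun _ => -1) (fun _ => 0)
  have hpts : ∀ M : PMatch n, charVec M.1 ∈ pmPolytope n := fun M => charVec_mem_pmPolytope M.2
  have hval : ∀ y ∈ pmPolytope n, ∀ j, a j ⬝ᵥ y ≤ b j := by
    intro y hy j
    cases j with
    | inl U => exact oddCutVec_le U.1 U.2 y hy
    | inr e =>
      simp only [a, b, Sum.elim_inr, neg_dotProduct, single_dotProduct, one_mul, neg_nonpos]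
      exact pmPolytope_nonneg y hy _
  have hfac := HasBlockPsdLift.hasPsdPowerFactorization_slack (x := fun M : PMatch n => charVec M.1)
    (a := a) (b := b) hk le_rfl (hasBlockPsdLift_one_iff.2 h) (isBounded_pmPolytope n) hpts hval
  have hfac' := (hasPsdPowerFactorization_one_iff.1 hfac).transpose
  -- the entries are those of `pmFullSlack`
  have hentry : (fun (j : OddSet n ⊕ Edge n) (M : PMatch n) => b j - a j ⬝ᵥ charVec M.1) =
      pmFullSlack n := by
    funext j M
    cases j with
    | inl U =>
      simp only [a, b, Sum.elim_inl, pmFullSlack_inl]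
      rw [oddCut_slack U.1 M.2, pmOddCutSlack_apply, cc_eq_card_filter]
    | inr e =>
      simp only [a, b, Sum.elim_inr, pmFullSlack_inr, neg_dotProduct, single_dotProduct, one_mul,
        zero_sub, neg_neg]
      rfl
  rwa [hentry] at hfac'

/-! ### Size zero does not occur -/

/-- For even `n ≥ 2` a psd lift of `P_PM(K_n)` has size `k ≥ 1`: a size-`0` lift `π(S^0_+ ∩ L)` is
contained in `{0}`, but `χ^M ≠ 0` for a perfect matching `M`. [cite: FawziEtAl2015, §3.1 eq. (3) (p09)] -/
theorem one_le_of_hasPsdLift_pmPolytope (hn : Even n) (h2 : 2 ≤ n)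
    (h : HasPsdLift (pmPolytope n) k) : 1 ≤ k := by
  classical
  by_contra hk
  have hk0 : k = 0 := by omega
  subst hk0
  obtain ⟨L, π, hC⟩ := h
  have hsub : pmPolytope n ⊆ {0} := by
    rw [hC]
    rintro _ ⟨M, -, rfl⟩
    have hM : M = 0 := Matrix.ext fun i _ => Fin.elim0 i
    rw [hM, map_zero]
    rfl
  obtain ⟨M₀, hM₀⟩ := exists_isPMOn_of_even n (univ : Finset (Fin n)) (by simp) hn
  have hmem := hsub (charVec_mem_pmPolytope hM₀)
  rw [Set.mem_singleton_iff] at hmem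
  obtain ⟨e, he, -⟩ := hM₀.exists_mem (Finset.mem_univ (⟨0, by omega⟩ : Fin n))
  have h1 : charVec M₀ ⟨e, hM₀.mem_edgeSet_top he⟩ = 1 := if_pos he
  rw [hmem] at h1
  exact one_ne_zero (h1.symm.trans rfl)

/-! ### Consequences: lower bounds on the size of psd lifts -/

/-- **Every psd lift of `P_PM(K_n)` has size `≥ C(n,2) − n + 1 = dim P_PM(K_n) + 1`** (`n ≥ 4` even):
Gouveia–Robinson–Thomas's `rank_psd(P) ≥ dim P + 1` for Edmonds' full slack matrix (tree theorem
`choose_two_sub_add_one_le_of_hasPsdFactorization`) carried to lifts by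
`hasPsdFactorization_pmFullSlack_of_hasPsdLift`.
[cite: GouveiaRobinsonThomas2013, Prop. 3.2 (p07)] [cite: FawziEtAl2015, Cor. 5.9 (p15) and Thm. 3.3 (p09)] -/
theorem choose_two_sub_add_one_le_of_hasPsdLift (hn : Even n) (h4 : 4 ≤ n)
    (h : HasPsdLift (pmPolytope n) k) : n.choose 2 - n + 1 ≤ k :=
  choose_two_sub_add_one_le_of_hasPsdFactorization hn h4
    (hasPsdFactorization_pmFullSlack_of_hasPsdLift
      (one_le_of_hasPsdLift_pmPolytope hn (by omega) h) h)

/-- **Every psd lift of the MATCHING polytope `P_M(K_n)` has size `≥ C(m,2) − m + 1`** for every even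
`m` with `4 ≤ m ≤ n` (`P_PM(K_m)` costs no more than `P_M(K_m)`, a face —
`hasPsdLift_pmPolytope_of_edmondsPolytope` — and `P_M(K_m)` no more than `P_M(K_n)` —
`hasPsdLift_edmondsPolytope_top_of_le`). [cite: GouveiaRobinsonThomas2013, Prop. 3.2 (p07)] [cite: Rothvoss2017, §1 (PDF p. 4, L40)] -/
theorem choose_two_sub_add_one_le_of_hasPsdLift_edmondsPolytope {m : ℕ} (hm : Even m)
    (h4 : 4 ≤ m) (hmn : m ≤ n)
    (h : HasPsdLift (edmondsPolytope (⊤ : SimpleGraph (Fin n))) k) :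
    m.choose 2 - m + 1 ≤ k :=
  choose_two_sub_add_one_le_of_hasPsdLift hm h4
    (hasPsdLift_pmPolytope_of_edmondsPolytope (hasPsdLift_edmondsPolytope_top_of_le hmn h))

/-- **Transfer principle**: a lower bound `K` on the psd rank of the odd-cut slack matrix of `K_n`
(`n ≥ 2` even) is a lower bound on the size of every psd lift of `P_PM(K_{n'})`, for every even
`n' ≥ n` (`hasPsdLift_pmPolytope_mono`). [cite: FawziEtAl2015, Thm. 3.3 (p09)] [cite: Rothvoss2017, §2 footnote (PDF p. 6)] -/
theorem psdLift_lowerBound_of_pmOddCutSlack {n n' K : ℕ} (hn : Even n) (h2 : 2 ≤ n)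
    (hle : n ≤ n') (hn' : Even n')
    (hK : ∀ r : ℕ, HasPsdFactorization (pmOddCutSlack n) r → K ≤ r) :
    ∀ k : ℕ, HasPsdLift (pmPolytope n') k → K ≤ k := fun k hk =>
  have hk' : HasPsdLift (pmPolytope n) k := hasPsdLift_pmPolytope_mono hle hn hn' hk
  hK k (hasPsdFactorization_pmOddCutSlack_of_hasPsdLift
    (one_le_of_hasPsdLift_pmPolytope hn h2 hk') hk')

/-- The same transfer for the FULL slack matrix (`n ≥ 2` even, every even `n' ≥ n`).
[cite: FawziEtAl2015, Thm. 3.3 (p09)] [cite: Rothvoss2017, §2 footnote (PDF p. 6)] -/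
theorem psdLift_lowerBound_of_pmFullSlack {n n' K : ℕ} (hn : Even n) (h2 : 2 ≤ n)
    (hle : n ≤ n') (hn' : Even n')
    (hK : ∀ r : ℕ, HasPsdFactorization (pmFullSlack n) r → K ≤ r) :
    ∀ k : ℕ, HasPsdLift (pmPolytope n') k → K ≤ k := fun k hk =>
  have hk' : HasPsdLift (pmPolytope n) k := hasPsdLift_pmPolytope_mono hle hn hn' hk
  hK k (hasPsdFactorization_pmFullSlack_of_hasPsdLift
    (one_le_of_hasPsdLift_pmPolytope hn h2 hk') hk')

/-! ### The converse: FGPRT Theorem 3.3 for `P_PM(K_n)` — psd lifts of size `k` exist iff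
`rk_psd(pmFullSlack n) ≤ k` -/

section Converse

/-- The edge of `K_n` in `EKn`-coordinates, back in `Edge`-coordinates. [cite: Edmonds1965, §2 (p. 125)] -/
def eknToEdge (e : EKn n) : Edge n :=
  ⟨e.1, by
    have h : (e : Sym2 (Fin n)) ∈ (Sym2.diagSet (α := Fin n))ᶜ := by
      rw [← SimpleGraph.edgeSet_top]; exact e.2
    exact h⟩

/-- `edgeToEKn ∘ eknToEdge = id`. [cite: Edmonds1965, §2 (p. 125)] -/
@[simp] theorem edgeToEKn_eknToEdge (e : EKn n) : edgeToEKn (eknToEdge e) = e :=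
  Subtype.ext rfl

/-- The incidence vector of the star `δ(v)` in `EKn`-coordinates. [cite: Edmonds1965, §2 (2) (p. 125)] -/
def starVec (v : Fin n) : EKn n → ℝ := fun e => if v ∈ (e : Sym2 (Fin n)) then 1 else 0

/-- `𝟙_{δ(v)} · y = y(δ(v))`. [cite: Edmonds1965, §2 (2) (p. 125)] -/
theorem starVec_dotProduct (v : Fin n) (y : EKn n → ℝ) :
    starVec v ⬝ᵥ y =
      ∑ e ∈ univ.filter (fun e : EKn n => v ∈ (e : Sym2 (Fin n))), y e := by
  simp only [starVec, dotProduct, ite_mul, one_mul, zero_mul]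
  rw [Finset.sum_filter]

/-- **The rows of Edmonds' description of `P_PM(K_n)` as ONE inequality family** `a_j · y ≤ b_j`:
odd-cut rows `−y(δ(U)) ≤ −1`, nonnegativity rows `−y_e ≤ 0`, and each degree EQUATION as the two
inequalities `y(δ(v)) ≤ 1`, `−y(δ(v)) ≤ −1`. [cite: Edmonds1965, §2 Thm. (P) (p. 126), perfect-matching form] -/
def edmondsPMRowLHS : (OddSet n ⊕ Edge n) ⊕ (Fin n ⊕ Fin n) → (EKn n → ℝ) :=
  Sum.elim (Sum.elim (fun U => oddCutVec U.1) (fun e => -Pi.single (edgeToEKn e) 1))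
    (Sum.elim (fun v => starVec v) (fun v => -starVec v))

/-- The right-hand sides `−1`, `0`, `1`, `−1`. [cite: Edmonds1965, §2 Thm. (P) (p. 126), perfect-matching form] -/
def edmondsPMRowRHS : (OddSet n ⊕ Edge n) ⊕ (Fin n ⊕ Fin n) → ℝ :=
  Sum.elim (Sum.elim (fun _ => -1) (fun _ => 0)) (Sum.elim (fun _ => 1) (fun _ => -1))

/-- **Edmonds' theorem in this form: `{y | a_j · y ≤ b_j ∀ j} = P_PM(K_n)`** (the tree's
`mem_pmPolytope_iff`). [cite: Edmonds1965, §2 Thm. (P) (p. 126), perfect-matching form] -/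
theorem setOf_edmondsPMRow_eq_pmPolytope (n : ℕ) :
    {y : EKn n → ℝ |
        ∀ j, edmondsPMRowLHS (n := n) j ⬝ᵥ y ≤ edmondsPMRowRHS (n := n) j} =
      pmPolytope n := by
  classical
  ext y
  rw [Set.mem_setOf_eq, mem_pmPolytope_iff]
  constructor
  · intro h
    refine ⟨fun e => ?_, fun v => ?_, fun U hU => h (Sum.inl (Sum.inl ⟨U, hU⟩))⟩
    · have h1 := h (Sum.inl (Sum.inr (eknToEdge e)))
      simp only [edmondsPMRowLHS, edmondsPMRowRHS, Sum.elim_inl, Sum.elim_inr, neg_dotProduct,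
        single_dotProduct, one_mul, edgeToEKn_eknToEdge, neg_nonpos] at h1
      exact h1
    · have h1 := h (Sum.inr (Sum.inl v))
      have h2 := h (Sum.inr (Sum.inr v))
      simp only [edmondsPMRowLHS, edmondsPMRowRHS, Sum.elim_inl, Sum.elim_inr, neg_dotProduct,
        starVec_dotProduct] at h1 h2
      linarith
  · rintro ⟨h0, hdeg, hodd⟩ j
    rcases j with (U | e) | (v | v)
    · exact hodd U.1 U.2
    · simp only [edmondsPMRowLHS, edmondsPMRowRHS, Sum.elim_inl, Sum.elim_inr, neg_dotProduct,
        single_dotProduct, one_mul, neg_nonpos]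
      exact h0 _
    · simp only [edmondsPMRowLHS, edmondsPMRowRHS, Sum.elim_inr, Sum.elim_inl, starVec_dotProduct]
      exact (hdeg v).le
    · simp only [edmondsPMRowLHS, edmondsPMRowRHS, Sum.elim_inr, neg_dotProduct,
        starVec_dotProduct]
      exact neg_le_neg (hdeg v).ge

/-- The vertices of `P_PM(K_n)` as a family indexed by `PMatch n`. [cite: Rothvoss2017, §1 (PDF p. 4)] -/
theorem range_charVec_eq (n : ℕ) :
    Set.range (fun M : PMatch n => charVec M.1) =
      {x | ∃ M : Finset (Sym2 (Fin n)), IsPMOn Finset.univ M ∧ x = charVec M} := by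
  ext x
  constructor
  · rintro ⟨M, rfl⟩
    exact ⟨M.1, M.2, rfl⟩
  · rintro ⟨M, hM, rfl⟩
    exact ⟨⟨M, hM⟩, rfl⟩

/-- `P_PM(K_n) = conv{χ^M : M ∈ PMatch n}`. [cite: Rothvoss2017, §1 (PDF p. 4)] -/
theorem convexHull_range_charVec (n : ℕ) :
    convexHull ℝ (Set.range (fun M : PMatch n => charVec M.1)) = pmPolytope n := by
  rw [range_charVec_eq]
  rfl

/-- **The slack matrix of the full inequality family**: on the odd-cut and edge rows it is `pmFullSlack`,
on the degree rows it vanishes. [cite: FawziEtAl2015, Def. 3.1 (p09)] -/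
theorem edmondsPMRow_slack (M : PMatch n) (j : (OddSet n ⊕ Edge n) ⊕ (Fin n ⊕ Fin n)) :
    edmondsPMRowRHS (n := n) j - edmondsPMRowLHS (n := n) j ⬝ᵥ charVec M.1 =
      Sum.elim (fun j' => pmFullSlack n j' M) (fun _ => (0 : ℝ)) j := by
  classical
  rcases j with (U | e) | (v | v)
  · simp only [edmondsPMRowLHS, edmondsPMRowRHS, Sum.elim_inl, pmFullSlack_inl]
    rw [oddCut_slack U.1 M.2, pmOddCutSlack_apply, cc_eq_card_filter]
  · simp only [edmondsPMRowLHS, edmondsPMRowRHS, Sum.elim_inl, Sum.elim_inr, pmFullSlack_inr,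
      neg_dotProduct, single_dotProduct, one_mul, zero_sub, neg_neg]
    rfl
  · simp only [edmondsPMRowLHS, edmondsPMRowRHS, Sum.elim_inr, Sum.elim_inl, starVec_dotProduct,
      sum_charVec_incident M.2 v, sub_self]
  · simp only [edmondsPMRowLHS, edmondsPMRowRHS, Sum.elim_inr, neg_dotProduct, starVec_dotProduct,
      sum_charVec_incident M.2 v, sub_self]

/-- A psd factorization of `pmFullSlack` extends to the degree rows (zero rows: factor `0`), in the
"points × inequalities" orientation of the cone-factorization theorem. [cite: FawziEtAl2015, Def. 3.1 and Remark 3.2 (p09)] -/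
theorem hasPsdFactorization_edmondsPMRow_slack_of_pmFullSlack
    (h : HasPsdFactorization (pmFullSlack n) k) :
    HasPsdFactorization (fun (M : PMatch n) (j : (OddSet n ⊕ Edge n) ⊕ (Fin n ⊕ Fin n)) =>
      edmondsPMRowRHS (n := n) j - edmondsPMRowLHS (n := n) j ⬝ᵥ charVec M.1) k := by
  obtain ⟨A, B, hA, hB, hS⟩ := h
  refine ⟨fun M => B M, Sum.elim (fun j' => A j') (fun _ => 0), fun M => hB M, ?_,
    fun M j => ?_⟩
  · rintro (j' | v)
    · exact hA j'
    · exact Matrix.PosSemidef.zero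
  · show edmondsPMRowRHS (n := n) j - edmondsPMRowLHS (n := n) j ⬝ᵥ charVec M.1 =
      (B M * Sum.elim (fun j' => A j') (fun _ => (0 : Matrix (Fin k) (Fin k) ℝ)) j).trace
    rw [edmondsPMRow_slack]
    rcases j with j' | v
    · simp only [Sum.elim_inl]
      rw [hS j' M, Matrix.trace_mul_comm]
    · simp only [Sum.elim_inr, Matrix.mul_zero, Matrix.trace_zero]

/-- **FGPRT Theorem 3.3 for the perfect matching polytope: `P_PM(K_n)` has a psd lift of size `k ≥ 1`
iff Edmonds' full slack matrix has a psd factorization of size `k`** ("the size of the smallest psd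
lift of a polytope `P` is equal to the psd rank of the slack matrix `S_P`"), via the tree's
cone-factorization theorem for polytopes `hasPsdPowerFactorization_slack_iff_hasBlockPsdLift` (one
block) and Edmonds' theorem `conv{χ^M} = {y | a_j · y ≤ b_j}` (`setOf_edmondsPMRow_eq_pmPolytope`).
[cite: FawziEtAl2015, Thm. 3.3 (p09)] [cite: GouveiaParriloThomas2013, Thm. 2.4 (§2)] [cite: Edmonds1965, §2 Thm. (P) (p. 126)] -/
theorem hasPsdLift_pmPolytope_iff_hasPsdFactorization_pmFullSlack (hk : 1 ≤ k) :
    HasPsdLift (pmPolytope n) k ↔ HasPsdFactorization (pmFullSlack n) k := by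
  classical
  refine ⟨hasPsdFactorization_pmFullSlack_of_hasPsdLift hk, fun h => ?_⟩
  have hPQ : convexHull ℝ (Set.range (fun M : PMatch n => charVec M.1)) =
      {y | ∀ j, edmondsPMRowLHS (n := n) j ⬝ᵥ y ≤ edmondsPMRowRHS (n := n) j} := by
    rw [convexHull_range_charVec, setOf_edmondsPMRow_eq_pmPolytope]
  have h1 :=
    hasPsdPowerFactorization_one_iff.2 (hasPsdFactorization_edmondsPMRow_slack_of_pmFullSlack h)
  have h2 := (hasPsdPowerFactorization_slack_iff_hasBlockPsdLift hk le_rfl hPQ).1 h1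
  rw [convexHull_range_charVec] at h2
  exact hasBlockPsdLift_one_iff.1 h2

/-- Hence, for even `n ≥ 2`, **the psd lift sizes of `P_PM(K_n)` are exactly the psd factorization sizes of
Edmonds' full slack matrix**: the two sets `{k | HasPsdLift (P_PM(K_n)) k}` and
`{k | HasPsdFactorization (pmFullSlack n) k}` coincide (size `0` occurs in neither).
[cite: FawziEtAl2015, Thm. 3.3 (p09)] -/
theorem setOf_hasPsdLift_pmPolytope_eq (hn : Even n) (h2 : 2 ≤ n) :
    {k : ℕ | HasPsdLift (pmPolytope n) k} =
      {k : ℕ | HasPsdFactorization (pmFullSlack n) k} := by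
  classical
  ext k
  simp only [Set.mem_setOf_eq]
  rcases Nat.eq_zero_or_pos k with rfl | hk
  · constructor
    · intro h
      exact absurd (one_le_of_hasPsdLift_pmPolytope hn h2 h) (by omega)
    · intro h
      exfalso
      -- a size-0 factorization forces a zero matrix, but the edge row of an edge of `M₀` is `1`
      obtain ⟨M₀, hM₀⟩ := exists_isPMOn_of_even n (univ : Finset (Fin n)) (by simp) hn
      obtain ⟨e, he, -⟩ := hM₀.exists_mem (Finset.mem_univ (⟨0, by omega⟩ : Fin n))
      have hzero :=
        (hasPsdFactorization_zero_iff.1 h) (Sum.inr ⟨e, hM₀.not_isDiag he⟩) ⟨M₀, hM₀⟩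
      rw [pmFullSlack_inr, pmVec_apply, if_pos he] at hzero
      exact one_ne_zero hzero
  · exact hasPsdLift_pmPolytope_iff_hasPsdFactorization_pmFullSlack hk

end Converse

/-! ### LP lifts are psd lifts: `xc(P_PM(K_n)) ≥ r ⇒` a psd lift of size `r + 1`; the window
`C(n,2) − n + 1 ≤ rk_psd(P_PM(K_n)) ≤ 2^{n+1} + 1` -/

section LP

/-- **Yannakakis for the full slack matrix**: an extended formulation of `P_PM(K_n)` of size `r` gives
a nonnegative factorization of size `r + 1` of Edmonds' full slack matrix (the tree's
`HasEFOfSize.exists_nonneg_factorization` — LP duality multipliers plus one constant coordinate — fed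
the points `χ^M` and the odd-cut and nonnegativity rows). [cite: Rothvoss2017, Thm. 4 (PDF p. 5)] [cite: FawziEtAl2015, Prop. 2.5 (p05)] -/
theorem hasNonnegFactorization_pmFullSlack_of_hasEF {r : ℕ} (h : HasEFOfSize (pmPolytope n) r) :
    HasNonnegFactorization (pmFullSlack n) (r + 1) := by
  classical
  obtain ⟨U, T, hU, hT, hfac⟩ := h.exists_nonneg_factorization (A := OddSet n ⊕ Edge n)
    (B := PMatch n) (fun M => charVec M.1) (fun M => charVec_mem_pmPolytope M.2)
    (fun j => edmondsPMRowLHS (n := n) (Sum.inl j)) (fun j => edmondsPMRowRHS (n := n) (Sum.inl j))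
    (fun j y hy => by
      have h1 := (setOf_edmondsPMRow_eq_pmPolytope n).symm.subset hy
      exact h1 (Sum.inl j))
  refine ⟨fun j l => U j (finSuccEquiv r l), fun l M => T M (finSuccEquiv r l), fun j l => hU _ _,
    fun l M => hT _ _, fun j M => ?_⟩
  have h1 := hfac j M
  rw [edmondsPMRow_slack M (Sum.inl j), Sum.elim_inl] at h1
  rw [h1]
  exact (Fintype.sum_equiv (finSuccEquiv r)
    (fun l => U j (finSuccEquiv r l) * T M (finSuccEquiv r l)) (fun i => U j i * T M i)
    fun _ => rfl).symm

/-- Hence a psd factorization of size `r + 1` of the full slack matrix (diagonal factors,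
`rank_psd ≤ rank_+`). [cite: FawziEtAl2015, Prop. 2.5 (p05)] -/
theorem hasPsdFactorization_pmFullSlack_of_hasEF {r : ℕ} (h : HasEFOfSize (pmPolytope n) r) :
    HasPsdFactorization (pmFullSlack n) (r + 1) := by
  obtain ⟨U, V, hU, hV, hS⟩ := hasNonnegFactorization_pmFullSlack_of_hasEF h
  exact HasPsdFactorization.of_nonnegFactorization U V hU hV hS

/-- **LP lifts are psd lifts**: an extended formulation of `P_PM(K_n)` with `r` inequalities yields a
psd lift of size `r + 1` (the `+1` is the constant coordinate of the slack-form convention).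
[cite: FawziEtAl2015, Prop. 2.5 (p05) and Thm. 3.3 (p09)] [cite: GouveiaParriloThomas2013, Thm. 2.4 (§2)] -/
theorem hasPsdLift_pmPolytope_of_hasEFOfSize {r : ℕ} (h : HasEFOfSize (pmPolytope n) r) :
    HasPsdLift (pmPolytope n) (r + 1) :=
  (hasPsdLift_pmPolytope_iff_hasPsdFactorization_pmFullSlack (by omega)).2
    (hasPsdFactorization_pmFullSlack_of_hasEF h)

/-- **`P_PM(K_n)` has a psd lift of size `2^{n+1} + 1`** (Edmonds' description as an LP lift,
`hasEFOfSize_pmPolytope_two_pow`). With `choose_two_sub_add_one_le_of_hasPsdLift` the kernel's window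
for the psd rank of the perfect matching polytope is `[C(n,2) − n + 1, 2^{n+1} + 1]`.
[cite: FawziEtAl2015, Prop. 2.5 (p05)] [cite: Rothvoss2017, §1 (PDF p. 4, L17–18)] -/
theorem hasPsdLift_pmPolytope_two_pow_succ (n : ℕ) :
    HasPsdLift (pmPolytope n) (2 ^ (n + 1) + 1) :=
  hasPsdLift_pmPolytope_of_hasEFOfSize (hasEFOfSize_pmPolytope_two_pow n)

/-- The same for the odd-cut slack matrix: `rk_psd(pmOddCutSlack n) ≤ 2^{n+1} + 1`.
[cite: FawziEtAl2015, Prop. 2.5 (p05)] [cite: Rothvoss2017, §1 (PDF p. 4, L17–18)] -/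
theorem hasPsdFactorization_pmOddCutSlack_two_pow_succ (n : ℕ) :
    HasPsdFactorization (pmOddCutSlack n) (2 ^ (n + 1) + 1) :=
  HasPsdFactorization.pmOddCutSlack_of_pmFullSlack
    (hasPsdFactorization_pmFullSlack_of_hasEF (hasEFOfSize_pmPolytope_two_pow n))

end LP

end Literature.Barriers.PneNP

end
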